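import Mathlib
import Summits.ValiantsHypothesis.ValiantsHypothesis.Theorems.LiouvilleSarnakAlignedTypeICharactersMod2nBilinearSieveZeroFreeInput
import Summits.ValiantsHypothesis.ValiantsHypothesis.Theorems.LiouvilleSarnakAlignedTypeICharactersMod2nBilinearSieveTopConductor
import HarnessLib

/-!
# Route LiouvilleSarnak — support `AlignedTypeI` (stmt-ValiantsHypothesis-21040), line `characters_mod_2n`:
# the leaf from a Postnikov–Gallagher-type zero-free region for `2`-power moduli (conditional by arrow)

* `alignedTypeI_of_twoPowerZFR` — ★ `HZ → AlignedTypeI`, `HZ` the zero-free-region hypothesis of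
  `…BilinearSieveZeroFreeInput.lean` (for every `A`, eventually in `j`, the primitive `χ (mod 2^j)` have no zeros `β + iγ`
  with `|γ| ≤ j³`, `β > 1 − A log j/j`): the window `H_Λ^window` of `alignedTypeI_of_windowPrimeCharSums`
  (`…BilinearSieveTopConductor.lean`) follows from `logWeightedPrimeCharSum_window_of_twoPowerZFR` (prime powers cost
  `2√t log t`).  With `…BilinearSieveFinal.lean` (Banks–Shparlinski 2019 Thm 2.2) this is the SECOND conditional closure of
  the leaf, now on a zero-free region of 1956/1972 vintage; the Linnik–Gallagher range and all bookkeeping are proved.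

HONEST FRAMING. CONDITIONAL RESULT (hypothesis by arrow); the leaf `AlignedTypeI` is NOT closed unconditionally; nothing
bears on `VP ≠ VNP` (NOT proved).
-/

set_option linter.dupNamespace false

noncomputable section

namespace Summit.ValiantsHypothesis.ValiantsHypothesis.Theorems.LiouvilleSarnak.AlignedTypeI.CharactersModTwoN

open Finset ArithmeticFunction
open scoped BigOperators

/-- ★ **`AlignedTypeI` from a Postnikov–Gallagher-type zero-free region for `2`-power moduli** (CONDITIONAL by arrow on
`HZ`: for every `A`, eventually in `j`, the primitive `χ (mod 2^j)` have no zeros `β + iγ` with `|γ| ≤ j³`,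
`β > 1 − A log j / j`).  The window statement `H_Λ^window` of `alignedTypeI_of_windowPrimeCharSums` follows from
`logWeightedPrimeCharSum_window_of_twoPowerZFR` (prime powers cost `2√t log t`). [folklore] -/
theorem alignedTypeI_of_twoPowerZFR
    (hZ : ∀ A : ℝ, 0 < A → ∃ j₀ : ℕ, ∀ j : ℕ, j₀ ≤ j → ∀ χ : DirichletCharacter ℂ (2 ^ j), χ.IsPrimitive →
      ∀ ρ : ℂ, χ.LFunction ρ = 0 → 0 < ρ.re → ρ.re < 1 → |ρ.im| ≤ (j : ℝ) ^ 3 →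
        ρ.re ≤ 1 - A * Real.log j / j) :
    Summit.ValiantsHypothesis.ValiantsHypothesis.Theses.LiouvilleSarnak.AlignedTypeI := by
  refine alignedTypeI_of_windowPrimeCharSums fun th hth η hη δ hδ B hB => ?_
  have hlog2 : 0 < Real.log 2 := Real.log_pos (by norm_num)
  -- the window in terms of `j`: `θ j log 2 ≤ log t ≤ ((B + 1)/δ + 1) j log 2`
  obtain ⟨j₀, hj₀⟩ := logWeightedPrimeCharSum_window_of_twoPowerZFR hZ th hth ((B + 1) / δ + 1) (by positivity)
    (η / 2) (by positivity)
  -- size threshold for the prime powers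
  obtain ⟨N, hN⟩ : ∃ N : ℕ, (16 / η) ^ 4 < (2 : ℝ) ^ N := pow_unbounded_of_one_lt _ (by norm_num : (1 : ℝ) < 2)
  obtain ⟨k₂, hk₂⟩ : ∃ k₂ : ℕ, (j₀ : ℝ) / δ + N / th ≤ k₂ := exists_nat_ge _
  refine ⟨k₂, fun k hk j hj1 hjδ hjk χ hχ a ha haB t ht ht2 => ?_⟩
  have hkR : (k₂ : ℝ) ≤ k := by exact_mod_cast hk
  have hNth : 0 ≤ (N : ℝ) / th := by positivity
  have hj₀δ : 0 ≤ (j₀ : ℝ) / δ := by positivity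
  have hj₀j : j₀ ≤ j := by
    have h1 : (j₀ : ℝ) / δ ≤ k := by linarith
    have h2 : (j₀ : ℝ) ≤ δ * k := by rw [div_le_iff₀ hδ] at h1; linarith
    exact_mod_cast h2.trans hjδ
  have haN : N ≤ a := by
    have h1 : (N : ℝ) / th ≤ k := by linarith
    have h2 : (N : ℝ) ≤ th * k := by rw [div_le_iff₀ hth] at h1; linarith
    exact_mod_cast h2.trans ha
  have ht1 : 1 ≤ t := le_trans Nat.one_le_two_pow ht
  have ht0 : (0 : ℝ) < t := by exact_mod_cast (show 0 < t by omega)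
  have htR : (2 : ℝ) ^ a ≤ t := by exact_mod_cast ht
  have hjR : (1 : ℝ) ≤ j := by exact_mod_cast hj1
  have hjk' : (j : ℝ) ≤ k := by exact_mod_cast hjk
  have hk1 : (1 : ℝ) ≤ k := hjR.trans hjk'
  -- the window hypotheses in terms of `log t`
  have hlo : th * j * Real.log 2 ≤ Real.log t := by
    have h1 : Real.log ((2 : ℝ) ^ a) ≤ Real.log t := Real.log_le_log (by positivity) htR
    rw [Real.log_pow] at h1
    have h2 : th * j * Real.log 2 ≤ th * k * Real.log 2 := by gcongr
    have h3 : th * k * Real.log 2 ≤ a * Real.log 2 := mul_le_mul_of_nonneg_right ha hlog2.le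
    linarith
  have hhi : Real.log t ≤ ((B + 1) / δ + 1) * j * Real.log 2 := by
    have ht2R : (t : ℝ) < (2 : ℝ) ^ (a + 1) := by exact_mod_cast ht2
    have h1 : Real.log t ≤ Real.log ((2 : ℝ) ^ (a + 1)) := Real.log_le_log ht0 ht2R.le
    rw [Real.log_pow] at h1
    push_cast at h1
    -- `a + 1 ≤ B k + 1 ≤ (B + 1) k ≤ ((B+1)/δ) j ≤ ((B+1)/δ + 1) j`
    have h2 : ((a : ℝ) + 1) * Real.log 2 ≤ ((B + 1) * k) * Real.log 2 := by
      refine mul_le_mul_of_nonneg_right ?_ hlog2.le; nlinarith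
    have h3 : (B + 1) * k ≤ (B + 1) / δ * j := by
      have h4 : (k : ℝ) ≤ j / δ := by rw [le_div_iff₀ hδ]; linarith
      calc (B + 1) * k ≤ (B + 1) * (j / δ) := mul_le_mul_of_nonneg_left h4 (by positivity)
        _ = (B + 1) / δ * j := by ring
    have h5 : (B + 1) / δ * j ≤ ((B + 1) / δ + 1) * j := by nlinarith
    nlinarith
  have hθ := hj₀ j hj₀j χ hχ t hlo hhi
  -- prime powers
  have hdiff := norm_sum_vonMangoldt_sub_logWeighted_le (fun n => χ (n : ZMod (2 ^ j)))
    (fun n => χ.norm_le_one _) t ht1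
  have hw : 16 / η ≤ Real.sqrt (Real.sqrt t) := by
    have h1 : (16 / η) ^ 4 ≤ (t : ℝ) :=
      hN.le.trans ((pow_le_pow_right₀ (by norm_num) haN).trans htR)
    have hs0 : 0 ≤ Real.sqrt (Real.sqrt (t : ℝ)) := Real.sqrt_nonneg _
    have hs4 : Real.sqrt (Real.sqrt (t : ℝ)) ^ 4 = (t : ℝ) := by
      have h2 : Real.sqrt (Real.sqrt (t : ℝ)) ^ 2 = Real.sqrt (t : ℝ) := Real.sq_sqrt (Real.sqrt_nonneg _)
      calc Real.sqrt (Real.sqrt (t : ℝ)) ^ 4 = (Real.sqrt (Real.sqrt (t : ℝ)) ^ 2) ^ 2 := by ring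
        _ = (t : ℝ) := by rw [h2, Real.sq_sqrt ht0.le]
    by_contra hlt
    rw [not_le] at hlt
    have : Real.sqrt (Real.sqrt (t : ℝ)) ^ 4 < (16 / η) ^ 4 := pow_lt_pow_left₀ hlt hs0 (by norm_num)
    linarith
  have herr := two_sqrt_mul_log_le ht0 hη hw
  calc ‖∑ n ∈ Finset.Ioc 0 t, ((vonMangoldt n : ℝ) : ℂ) * χ (n : ZMod (2 ^ j))‖
      ≤ ‖∑ p ∈ (Finset.Iic t).filter Nat.Prime, (Real.log p : ℂ) * χ (p : ZMod (2 ^ j))‖ +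
          ‖∑ n ∈ Finset.Ioc 0 t, ((vonMangoldt n : ℝ) : ℂ) * χ (n : ZMod (2 ^ j)) -
            ∑ p ∈ (Finset.Iic t).filter Nat.Prime, (Real.log p : ℂ) * χ (p : ZMod (2 ^ j))‖ :=
        norm_le_norm_add_norm_sub' _ _
    _ ≤ η / 2 * t + 2 * Real.sqrt t * Real.log t := add_le_add hθ hdiff
    _ ≤ η / 2 * t + η * t / 2 := by linarith
    _ = η * t := by ring

end Summit.ValiantsHypothesis.ValiantsHypothesis.Theorems.LiouvilleSarnak.AlignedTypeI.CharactersModTwoN
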